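import Mathlib
import HarnessLib

/-!
# `DensityLadder.SeparatedTowerDensityLine` (item stmt-RiemannHypothesis-24918) — finiteness of
# the tame zeros in a bounded height range (bookkeeping for stub S1)

LINE L57 «sieve sight above the density line» (rh-idea-10 g1), crux K1 `SeparatedTowerDensityLine`,
stub S1 of the registered skeleton `Birth.lean`.  The K1 tame hypothesis says that every unit window
`{i : Re ρ_i ≤ 1/2, |Im ρ_i − t| ≤ 1}` is finite (with mass `≤ C log(|t|+2)`); hence the tame zeros
with `|Im ρ_i| ≤ R` form a finite set (union of the windows at the integer heights `|n| ≤ R`), which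
provides the finite truncation of the tame sum used in the mean-value step.
Cell rh-split, seat rh-split-prover-l57 g0.  RH-free, ζ-free; FRONTIER bookkeeping; nothing here
bears on the truth of RH.
-/

set_option linter.dupNamespace false

noncomputable section

open Set

namespace Summit.RiemannHypothesis.RiemannHypothesis.Theorems.DensityLadderSeparatedTowerTameFinite

/-- **Tame zeros of bounded height are finitely many**: if every unit window of the indices
satisfying `P` is finite, then `{i | P i ∧ |γ_i| ≤ R}` is finite. [folklore] -/
theorem finite_of_windows_finite {ι : Type} (γ : ι → ℝ) (P : ι → Prop)
    (hwin : ∀ t : ℝ, {i : ι | P i ∧ |γ i - t| ≤ 1}.Finite) (R : ℝ) :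
    {i : ι | P i ∧ |γ i| ≤ R}.Finite := by
  set N : ℕ := ⌈R⌉₊ with hN
  have hsub : {i : ι | P i ∧ |γ i| ≤ R} ⊆
      ⋃ n ∈ Finset.Icc (-(N : ℤ)) N, {i : ι | P i ∧ |γ i - (n : ℝ)| ≤ 1} := by
    intro i hi
    rw [mem_iUnion₂]
    refine ⟨⌊γ i⌋, ?_, hi.1, ?_⟩
    · rw [Finset.mem_Icc]
      have hR : |γ i| ≤ N := hi.2.trans (Nat.le_ceil R)
      have h := abs_le.1 hR
      constructor
      · have : (-(N : ℤ) : ℤ) = ⌊(-(N : ℝ))⌋ := by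
          rw [show (-(N : ℝ)) = ((-(N : ℤ) : ℤ) : ℝ) by push_cast; ring, Int.floor_intCast]
        rw [this]; exact Int.floor_le_floor h.1
      · exact Int.floor_le_iff.2 (by push_cast; linarith [h.2])
    · have h1 := Int.floor_le (γ i); have h2 := Int.lt_floor_add_one (γ i)
      rw [abs_le]; constructor <;> linarith
  refine Set.Finite.subset ?_ hsub
  exact Set.Finite.biUnion (Finset.finite_toSet (Finset.Icc (-(N : ℤ)) N)) fun n _ ↦ hwin (n : ℝ)

end Summit.RiemannHypothesis.RiemannHypothesis.Theorems.DensityLadderSeparatedTowerTameFinite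

end
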